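import Summits.Ventures.PercRepro.C025ProfileGenRule
import Summits.Ventures.PercRepro.C025ProfileRankFourCapCA
import Summits.Ventures.PercRepro.C025ProfileRankFourCapCB

/-!
# The general certificate: (Cap)(c), the counting lemma and the per-type facts in every rank (night-3 g8)

NIGHT3-G8-GENERAL-CERTIFICATE.md §3(c) for `S = T₀ ∪ {u}` (`T₀` a collinear triple on the line `L = cl T₀`, `u ∉ L`):
the counting lemma `cap_sum_le_of_bounds_g` (the tree's `cap_sum_le_of_bounds` for `wgn`); the triple's weight bounds
with `p₀ ≤ r + 1` in place of `p₀ ≤ 4` (`wgn_le_of_sdiff_singleton_three_le_card`); the submodular bound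
`crk_le_crk_add_one_of_sdiff_subset_clF` (`ρ(E∖B) ≤ ρ((E∖S) ∪ L) ≤ r + 1` when a point of `L` lies outside `S`); the
line of an inner pair is `L` (`clF_pair_eq_of_subset_line`), so its `j` is `min(2, |L| − 2)` (`jB_pair_eq_of_subset_line`);
and when `L ⊆ cl(E∖S)` the `u`-pairs have `ρ(E ∖ {x,u}) = r` (`crk_pair_u_eq_of_line_subset`) and every pair
`ρ(E ∖ {x,y}) ≤ r + 1` (`crk_pair_inner_le_of_line_subset`).
-/

open scoped Matroid

namespace PercRepro

open Set Finset ThmH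

section GenCapCA

variable {α : Type} [DecidableEq α] {M : Matroid α} [M.Finite]

/-- **The counting lemma of (Cap)(c) for `wgn`**: if `T₀` pays at most `c₀`, every pair inside `T₀` at most `c₁` and
every pair `{x, u}` at most `c₂`, then `S = T₀ ∪ {u}` is paid at most `c₀ + 3c₁ + 3c₂`. -/
theorem cap_sum_le_of_bounds_g (hsimple : ∀ T ⊆ M.E, T.encard ≤ 2 → M.Indep T) {S T₀ : Finset α} {u : α}
    (hS : S ∈ Shadow.levelSet M 3) (hS4 : S.card = 4) (hT₀S : T₀ ⊆ S) (hT₀c : T₀.card = 3)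
    (hT₀2 : M.eRk (T₀ : Set α) = 2) (huS : u ∈ S) (huT : u ∉ T₀) {c₀ c₁ c₂ : ℚ}
    (h₀ : wgn M T₀ S ≤ c₀) (h₁ : ∀ B ⊆ T₀, B.card = 2 → wgn M B S ≤ c₁)
    (h₂ : ∀ B ⊆ S, B.card = 2 → u ∈ B → wgn M B S ≤ c₂) :
    ∑ B ∈ (Profile.Rq M 2).filter (fun B => B ⊆ S), wgn M B S ≤ c₀ + 3 * c₁ + 3 * c₂ := by
  classical
  set Φ := (Profile.Rq M 2).filter (fun B => B ⊆ S) with hΦ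
  have hSg : S ⊆ gr M := (Profile.mem_levelSet.1 hS).1
  have hT₀g : T₀ ⊆ gr M := hT₀S.trans hSg
  have huE : u ∈ M.E := by rw [← coe_gr]; exact_mod_cast hSg huS
  have hSeq : S = insert u T₀ := by
    apply Finset.eq_of_subset_of_card_le
    · intro x hx
      rw [Finset.mem_insert]
      by_cases hxu : x = u
      · exact Or.inl hxu
      · right
        by_contra hxT
        have hsub : insert x (insert u T₀) ⊆ S := by
          intro w hw
          rw [Finset.mem_insert, Finset.mem_insert] at hw
          rcases hw with rfl | rfl | hw
          · exact hx
          · exact huS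
          · exact hT₀S hw
        have := Finset.card_le_card hsub
        rw [Finset.card_insert_of_notMem, Finset.card_insert_of_notMem huT, hT₀c, hS4] at this
        · omega
        · rw [Finset.mem_insert, not_or]; exact ⟨hxu, hxT⟩
    · rw [Finset.card_insert_of_notMem huT, hT₀c, hS4]
  have huL : u ∉ clF M T₀ := notMem_clF_of_insert_eRk_three hT₀g hT₀2 (by rw [← hSeq]; exact (Profile.mem_levelSet.1 hS).2)
  have hcard : ∀ B ∈ Φ, B.card = 2 ∨ B.card = 3 := by
    intro B hB
    have hBS : B ⊆ S := (Finset.mem_filter.1 hB).2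
    have h2 := two_le_card_of_mem_Rq_two (Finset.mem_filter.1 hB).1
    have hne := ne_of_mem_filter_levelSet hS hB
    have hle := Finset.card_le_card hBS
    have hB4 : B.card ≠ 4 := by
      intro h4
      exact hne (Finset.eq_of_subset_of_card_le hBS (by omega))
    omega
  have htriple : ∀ B ∈ Φ, B.card = 3 → B = T₀ := by
    intro B hB hB3
    have hBS : B ⊆ S := (Finset.mem_filter.1 hB).2
    have hB2 : M.eRk (B : Set α) = 2 := (Profile.mem_Rq.1 (Finset.mem_filter.1 hB).1).2
    by_contra hne
    have huB : u ∈ B := by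
      by_contra huB
      apply hne
      apply Finset.eq_of_subset_of_card_le
      · intro x hx
        have := hBS hx
        rw [hSeq, Finset.mem_insert] at this
        rcases this with rfl | h
        · exact absurd hx huB
        · exact h
      · omega
    have hc : 2 ≤ (B.erase u).card := by rw [Finset.card_erase_of_mem huB]; omega
    obtain ⟨U, hUB, hUc⟩ := Finset.exists_subset_card_eq hc
    obtain ⟨a, b, hab, hU⟩ := Finset.card_eq_two.1 hUc
    have haB : a ∈ B.erase u := hUB (by rw [hU]; exact Finset.mem_insert_self _ _)
    have hbB : b ∈ B.erase u := hUB (by rw [hU]; exact Finset.mem_insert_of_mem (Finset.mem_singleton_self _))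
    have hmemT : ∀ x ∈ B.erase u, x ∈ T₀ := by
      intro x hx
      rw [Finset.mem_erase] at hx
      have := hBS hx.2
      rw [hSeq, Finset.mem_insert] at this
      rcases this with h | h
      · exact absurd h hx.1
      · exact h
    have h3 := eRk_eq_three_of_two_mem_line hsimple hT₀g hT₀2 huE huL (by rw [← hSeq]; exact hBS) huB hab
      (Finset.mem_erase.1 haB).2 (Finset.mem_erase.1 hbB).2 (hmemT a haB) (hmemT b hbB)
    rw [hB2] at h3
    exact absurd h3 (by decide)
  have hsplit : ∑ B ∈ Φ, wgn M B S =
      ∑ B ∈ Φ.filter (fun B => B.card = 3), wgn M B S + ∑ B ∈ Φ.filter (fun B => ¬ B.card = 3), wgn M B S :=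
    (Finset.sum_filter_add_sum_filter_not _ _ _).symm
  have hpart3 : ∑ B ∈ Φ.filter (fun B => B.card = 3), wgn M B S ≤ c₀ := by
    have hsub : Φ.filter (fun B => B.card = 3) ⊆ {T₀} := by
      intro B hB
      rw [Finset.mem_filter] at hB
      rw [Finset.mem_singleton]
      exact htriple B hB.1 hB.2
    calc ∑ B ∈ Φ.filter (fun B => B.card = 3), wgn M B S ≤ ∑ B ∈ ({T₀} : Finset (Finset α)), wgn M B S :=
          Finset.sum_le_sum_of_subset_of_nonneg hsub (fun B _ _ => wgn_nonneg B S)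
      _ = wgn M T₀ S := Finset.sum_singleton _ _
      _ ≤ c₀ := h₀
  have hpart2 : ∑ B ∈ Φ.filter (fun B => ¬ B.card = 3), wgn M B S ≤ 3 * c₁ + 3 * c₂ := by
    have hsub : Φ.filter (fun B => ¬ B.card = 3) ⊆ S.powersetCard 2 := by
      intro B hB
      rw [Finset.mem_filter] at hB
      rw [Finset.mem_powersetCard]
      refine ⟨(Finset.mem_filter.1 hB.1).2, ?_⟩
      rcases hcard B hB.1 with h | h
      · exact h
      · exact absurd h hB.2
    have hsplit2 : ∑ B ∈ S.powersetCard 2, wgn M B S =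
        ∑ B ∈ (S.powersetCard 2).filter (fun B => u ∈ B), wgn M B S +
          ∑ B ∈ (S.powersetCard 2).filter (fun B => ¬ u ∈ B), wgn M B S :=
      (Finset.sum_filter_add_sum_filter_not _ _ _).symm
    have hin : (S.powersetCard 2).filter (fun B => ¬ u ∈ B) = T₀.powersetCard 2 := by
      ext B
      rw [Finset.mem_filter, Finset.mem_powersetCard, Finset.mem_powersetCard]
      constructor
      · rintro ⟨⟨hBS, hBc⟩, huB⟩
        refine ⟨?_, hBc⟩
        intro x hx
        have := hBS hx
        rw [hSeq, Finset.mem_insert] at this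
        rcases this with rfl | h
        · exact absurd hx huB
        · exact h
      · rintro ⟨hBT, hBc⟩
        exact ⟨⟨hBT.trans hT₀S, hBc⟩, fun h => huT (hBT h)⟩
    have hcard_in : ((S.powersetCard 2).filter (fun B => ¬ u ∈ B)).card = 3 := by
      rw [hin, Finset.card_powersetCard, hT₀c]; decide
    have hcard_u : ((S.powersetCard 2).filter (fun B => u ∈ B)).card = 3 := by
      have htot := Finset.card_filter_add_card_filter_not (s := S.powersetCard 2) (fun B => u ∈ B)
      rw [hcard_in, Finset.card_powersetCard, hS4] at htot
      have : Nat.choose 4 2 = 6 := by decide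
      omega
    have hb_u : ∑ B ∈ (S.powersetCard 2).filter (fun B => u ∈ B), wgn M B S ≤ 3 * c₂ := by
      calc ∑ B ∈ (S.powersetCard 2).filter (fun B => u ∈ B), wgn M B S
          ≤ ∑ _B ∈ (S.powersetCard 2).filter (fun B => u ∈ B), c₂ := by
            apply Finset.sum_le_sum
            intro B hB
            rw [Finset.mem_filter, Finset.mem_powersetCard] at hB
            exact h₂ B hB.1.1 hB.1.2 hB.2
        _ = 3 * c₂ := by rw [Finset.sum_const, nsmul_eq_mul, hcard_u]; push_cast; ring
    have hb_in : ∑ B ∈ (S.powersetCard 2).filter (fun B => ¬ u ∈ B), wgn M B S ≤ 3 * c₁ := by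
      calc ∑ B ∈ (S.powersetCard 2).filter (fun B => ¬ u ∈ B), wgn M B S
          ≤ ∑ _B ∈ (S.powersetCard 2).filter (fun B => ¬ u ∈ B), c₁ := by
            apply Finset.sum_le_sum
            intro B hB
            rw [hin, Finset.mem_powersetCard] at hB
            exact h₁ B hB.1 hB.2
        _ = 3 * c₁ := by rw [Finset.sum_const, nsmul_eq_mul, hcard_in]; push_cast; ring
    calc ∑ B ∈ Φ.filter (fun B => ¬ B.card = 3), wgn M B S ≤ ∑ B ∈ S.powersetCard 2, wgn M B S :=
          Finset.sum_le_sum_of_subset_of_nonneg hsub (fun B _ _ => wgn_nonneg B S)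
      _ = _ := hsplit2
      _ ≤ 3 * c₂ + 3 * c₁ := add_le_add hb_u hb_in
      _ = 3 * c₁ + 3 * c₂ := by ring
  rw [hsplit]
  linarith

/-- The triple's weight with one extra point, `|B| ≥ 3`: `0` when `r ≤ 1`; `≤ 1` when `j = 0`; `≤ (r+1)/r` when
`j = 1` and `r ≥ 2`; `≤ (r+1)/(r−1)` when `j = 2` and `r ≥ 3` (all from `p ≤ r + 1`). -/
theorem wgn_le_of_sdiff_singleton_three_le_card {B S : Finset α} {y : α} (hy : S \ B = {y}) (hB3 : 3 ≤ B.card) :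
    (crk M S ≤ 1 → wgn M B S = 0) ∧ (jB M B = 0 → wgn M B S ≤ 1) ∧
    (jB M B = 1 → 2 ≤ crk M S → wgn M B S ≤ ((crk M S : ℚ) + 1) / (crk M S : ℚ)) ∧
    (jB M B = 2 → 3 ≤ crk M S → wgn M B S ≤ ((crk M S : ℚ) + 1) / ((crk M S : ℚ) - 1)) := by
  have hpr : crk M B ≤ crk M S + 1 := crk_le_crk_add_one_of_sdiff_singleton hy
  have hprq : (crk M B : ℚ) ≤ (crk M S : ℚ) + 1 := by exact_mod_cast hpr
  have hrnn : (0 : ℚ) ≤ (crk M S : ℚ) := Nat.cast_nonneg _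
  by_cases hp3 : crk M B < 3
  · rw [wgn_eq_zero_of_crk_lt_three hp3]
    refine ⟨fun _ => rfl, fun _ => by norm_num, fun _ hr => ?_, fun _ hr => ?_⟩
    · have : (2 : ℚ) ≤ (crk M S : ℚ) := by exact_mod_cast hr
      positivity
    · have : (3 : ℚ) ≤ (crk M S : ℚ) := by exact_mod_cast hr
      apply div_nonneg (by linarith) (by linarith)
  push Not at hp3
  have hsd : (S \ B).card = 1 := by rw [hy, Finset.card_singleton]
  refine ⟨fun hr => absurd hpr (by omega), ?_, ?_, ?_⟩
  · intro hj
    unfold wgn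
    rw [wg_of_sdiff_card_one_of_three_le_card hsd hB3 hp3, hj]
    apply max_le (by norm_num)
    have hrpos : (0 : ℚ) < (crk M S : ℚ) + 1 - ((0 : ℕ) : ℚ) := by push_cast; linarith
    rw [div_le_iff₀ hrpos]; push_cast; linarith
  · intro hj hr
    have hrq : (2 : ℚ) ≤ (crk M S : ℚ) := by exact_mod_cast hr
    unfold wgn
    rw [wg_of_sdiff_card_one_of_three_le_card hsd hB3 hp3, hj]
    apply max_le (by positivity)
    have hrpos : (0 : ℚ) < (crk M S : ℚ) + 1 - ((1 : ℕ) : ℚ) := by push_cast; linarith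
    rw [div_le_div_iff₀ hrpos (by linarith)]
    push_cast
    nlinarith
  · intro hj hr
    have hrq : (3 : ℚ) ≤ (crk M S : ℚ) := by exact_mod_cast hr
    unfold wgn
    rw [wg_of_sdiff_card_one_of_three_le_card hsd hB3 hp3, hj]
    apply max_le (div_nonneg (by linarith) (by linarith))
    have hrpos : (0 : ℚ) < (crk M S : ℚ) + 1 - ((2 : ℕ) : ℚ) := by push_cast; linarith
    rw [div_le_div_iff₀ hrpos (by linarith)]
    push_cast
    nlinarith

/-- Submodularity: if a point `v` of the line `L = cl T₀` lies outside `S` and `S ∖ B ⊆ L`, then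
`ρ(E∖B) ≤ ρ((E∖S) ∪ L) ≤ ρ(E∖S) + 1`. -/
theorem crk_le_crk_add_one_of_sdiff_subset_clF (hsimple : ∀ T ⊆ M.E, T.encard ≤ 2 → M.Indep T) {B S T₀ : Finset α}
    (hT₀2 : M.eRk (T₀ : Set α) = 2) {v : α} (hv : v ∈ clF M T₀) (hvS : v ∉ S) (hsub : S \ B ⊆ clF M T₀) :
    crk M B ≤ crk M S + 1 := by
  set X : Set α := ((gr M \ S : Finset α) : Set α) with hX
  set Y : Set α := ((clF M T₀ : Finset α) : Set α) with hY
  have hXr : M.eRk X = (crk M S : ℕ∞) := by rw [hX, eRk_gr_sdiff_eq_crk]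
  have hYr : M.eRk Y = 2 := eRk_clF_of_eRk_two hT₀2
  have hvg : v ∈ gr M := clF_subset_gr T₀ hv
  have hvE : v ∈ M.E := by rw [← coe_gr]; exact_mod_cast hvg
  have hvXY : v ∈ X ∩ Y := by
    rw [Set.mem_inter_iff, hX, hY, Finset.mem_coe, Finset.mem_coe]
    exact ⟨Finset.mem_sdiff.2 ⟨hvg, hvS⟩, hv⟩
  have hind : M.Indep ({v} : Set α) :=
    hsimple _ (Set.singleton_subset_iff.2 hvE) (by rw [Set.encard_singleton]; exact one_le_two)
  have hXY1 : (1 : ℕ∞) ≤ M.eRk (X ∩ Y) := by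
    calc (1 : ℕ∞) = M.eRk ({v} : Set α) := by rw [hind.eRk_eq_encard, Set.encard_singleton]
      _ ≤ M.eRk (X ∩ Y) := M.eRk_mono (Set.singleton_subset_iff.2 hvXY)
  have hsm := M.eRk_inter_add_eRk_union_le X Y
  have hfin : M.eRk (X ∪ Y) ≠ ⊤ := by
    rw [← lt_top_iff_ne_top]; exact (M.isRkFinite_set _).eRk_lt_top
  obtain ⟨n, hn⟩ := ENat.ne_top_iff_exists.1 hfin
  have hn1 : n ≤ crk M S + 1 := by
    have h1 : (1 : ℕ∞) + (n : ℕ∞) ≤ (crk M S : ℕ∞) + 2 := by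
      calc (1 : ℕ∞) + (n : ℕ∞) ≤ M.eRk (X ∩ Y) + M.eRk (X ∪ Y) := by rw [hn]; exact add_le_add_left hXY1 _
        _ ≤ M.eRk X + M.eRk Y := hsm
        _ = (crk M S : ℕ∞) + 2 := by rw [hXr, hYr]
    have : (1 : ℕ) + n ≤ crk M S + 2 := by exact_mod_cast h1
    omega
  have hBsub : ((gr M \ B : Finset α) : Set α) ⊆ X ∪ Y := by
    intro x hx
    rw [Finset.mem_coe, Finset.mem_sdiff] at hx
    rw [Set.mem_union, hX, hY, Finset.mem_coe, Finset.mem_coe]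
    by_cases hxS : x ∈ S
    · exact Or.inr (hsub (Finset.mem_sdiff.2 ⟨hxS, hx.2⟩))
    · exact Or.inl (Finset.mem_sdiff.2 ⟨hx.1, hxS⟩)
  have h := M.eRk_mono hBsub
  rw [eRk_gr_sdiff_eq_crk, ← hn] at h
  have : crk M B ≤ n := by exact_mod_cast h
  omega

/-- The line of a pair of a collinear triple is the line of the triple. -/
theorem clF_pair_eq_of_subset_line (hsimple : ∀ T ⊆ M.E, T.encard ≤ 2 → M.Indep T) {T₀ : Finset α}
    (hT₀g : T₀ ⊆ gr M) (hT₀2 : M.eRk (T₀ : Set α) = 2) {x y : α} (hxy : x ≠ y) (hx : x ∈ T₀) (hy : y ∈ T₀) :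
    clF M {x, y} = clF M T₀ := by
  have hsub : ({x, y} : Finset α) ⊆ T₀ := by
    intro w hw
    rw [Finset.mem_insert, Finset.mem_singleton] at hw
    rcases hw with rfl | rfl
    · exact hx
    · exact hy
  apply Finset.Subset.antisymm
  · rw [← Finset.coe_subset, coe_clF, coe_clF]
    exact M.closure_subset_closure (Finset.coe_subset.2 hsub)
  · rw [← Finset.coe_subset, coe_clF M ({x, y} : Finset α), Finset.coe_pair]
    exact clF_subset_closure_of_two_mem hsimple hT₀2 hxy (subset_clF_self hT₀g hx) (subset_clF_self hT₀g hy)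
      (Set.mem_insert _ _) (Set.mem_insert_of_mem _ (Set.mem_singleton _))

/-- The `j` of a pair of a collinear triple is `min(2, |L| − 2)`. -/
theorem jB_pair_eq_of_subset_line (hsimple : ∀ T ⊆ M.E, T.encard ≤ 2 → M.Indep T) {T₀ : Finset α}
    (hT₀g : T₀ ⊆ gr M) (hT₀2 : M.eRk (T₀ : Set α) = 2) {x y : α} (hxy : x ≠ y) (hx : x ∈ T₀) (hy : y ∈ T₀) :
    jB M {x, y} = min 2 ((clF M T₀).card - 2) := by
  unfold jB
  rw [clF_pair_eq_of_subset_line hsimple hT₀g hT₀2 hxy hx hy, Finset.card_pair hxy]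

/-- When the line `L = cl T₀` lies in `cl(E∖S)` (`S = T₀ ∪ {u}`), a `u`-pair has `ρ(E ∖ {x, u}) = ρ(E∖S)`. -/
theorem crk_pair_u_eq_of_line_subset {S T₀ : Finset α} {u x : α} (hSeq : S = insert u T₀) (hT₀g : T₀ ⊆ gr M)
    (hline : ((clF M T₀ : Finset α) : Set α) ⊆ M.closure ((gr M \ S : Finset α) : Set α)) (hx : x ∈ T₀) :
    crk M {x, u} = crk M S := by
  apply le_antisymm
  · -- E ∖ {x, u} ⊆ cl(E ∖ S)
    have hsub : ((gr M \ ({x, u} : Finset α) : Finset α) : Set α) ⊆ M.closure ((gr M \ S : Finset α) : Set α) := by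
      intro w hw
      rw [Finset.mem_coe, Finset.mem_sdiff, Finset.mem_insert, Finset.mem_singleton, not_or] at hw
      by_cases hwS : w ∈ S
      · rw [hSeq, Finset.mem_insert] at hwS
        rcases hwS with rfl | hwT
        · exact absurd rfl hw.2.2
        · exact hline (subset_clF_self hT₀g hwT)
      · exact M.subset_closure _ (by rw [Finset.coe_sdiff, coe_gr]; exact Set.sdiff_subset)
          (by rw [Finset.mem_coe]; exact Finset.mem_sdiff.2 ⟨hw.1, hwS⟩)
    have h := M.eRk_mono hsub
    rw [M.eRk_closure_eq, eRk_gr_sdiff_eq_crk, eRk_gr_sdiff_eq_crk] at h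
    exact_mod_cast h
  · apply crk_le_crk_of_subset
    intro w hw
    rw [Finset.mem_insert, Finset.mem_singleton] at hw
    rw [hSeq, Finset.mem_insert]
    rcases hw with rfl | rfl
    · exact Or.inr hx
    · exact Or.inl rfl

/-- When the line `L = cl T₀` lies in `cl(E∖S)` (`S = T₀ ∪ {u}`), an inner pair has `ρ(E ∖ {x, y}) ≤ ρ(E∖S) + 1`. -/
theorem crk_pair_inner_le_of_line_subset {S T₀ : Finset α} {u x y : α} (hSeq : S = insert u T₀) (hT₀g : T₀ ⊆ gr M)
    (hline : ((clF M T₀ : Finset α) : Set α) ⊆ M.closure ((gr M \ S : Finset α) : Set α)) :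
    crk M {x, y} ≤ crk M S + 1 := by
  -- E ∖ {x, y} ⊆ insert u (cl(E ∖ S))
  have hsub : ((gr M \ ({x, y} : Finset α) : Finset α) : Set α) ⊆
      insert u (M.closure ((gr M \ S : Finset α) : Set α)) := by
    intro w hw
    rw [Finset.mem_coe, Finset.mem_sdiff, Finset.mem_insert, Finset.mem_singleton, not_or] at hw
    rw [Set.mem_insert_iff]
    by_cases hwS : w ∈ S
    · rw [hSeq, Finset.mem_insert] at hwS
      rcases hwS with rfl | hwT
      · exact Or.inl rfl
      · exact Or.inr (hline (subset_clF_self hT₀g hwT))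
    · right
      exact M.subset_closure _ (by rw [Finset.coe_sdiff, coe_gr]; exact Set.sdiff_subset)
        (by rw [Finset.mem_coe]; exact Finset.mem_sdiff.2 ⟨hw.1, hwS⟩)
  have h : M.eRk ((gr M \ ({x, y} : Finset α) : Finset α) : Set α) ≤ M.eRk ((gr M \ S : Finset α) : Set α) + 1 := by
    calc M.eRk ((gr M \ ({x, y} : Finset α) : Finset α) : Set α)
        ≤ M.eRk (insert u (M.closure ((gr M \ S : Finset α) : Set α))) := M.eRk_mono hsub
      _ ≤ M.eRk (M.closure ((gr M \ S : Finset α) : Set α)) + 1 := M.eRk_insert_le_add_one _ _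
      _ = M.eRk ((gr M \ S : Finset α) : Set α) + 1 := by rw [M.eRk_closure_eq]
  rw [eRk_gr_sdiff_eq_crk, eRk_gr_sdiff_eq_crk] at h
  exact_mod_cast h

end GenCapCA

end PercRepro
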